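import Summits.QuantumFields.BalabanUV.Beta.FP.SymmetryInherit
import Summits.QuantumFields.BalabanUV.Beta.HessKerConvCKPlug
import Summits.QuantumFields.BalabanUV.Beta.GAN24.KSlotAssembly

/-!
# `BalabanUV.Beta.FP.SymmetryInheritHolds` — road «FP» for binder row D1, leaf N3-inherit at the perfect triple (`m = 1`) WITH THE K-ROWS DISCHARGED
# (`d = 3`, every `Lc ≥ 2`, adopted units `(sfStep Lc, smStep 3 Lc)`): the wall's family converges entrywise to the perfect one-step kernel, and
# `flipK (TPerf 1)` inherits axis-reflection covariance (5.7)–(5.8) / Ward transversality (5.9) from the finite-`j` rows `hR` / `hW`, GIVEN ONLY the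
# S- and W-slot Cauchy rows (at their own rates) — the K-slot comes from gan24's END `GAN24.KSlotAssembly.convCKWall_holds` (p204341), the rate /
# window merge from asym1's `HessKerConvCKPlug.exists_merged_rows`, BY NAME

HONEST FRAMING (cell contract, verbatim): «discharging `BetaPertH` makes Bałaban's UV stability UNCONDITIONAL — a real constructive-QFT result;
it is NOT the continuum limit and NOT the Clay problem.»  HEADLINE DISCIPLINE: each theorem removes EXACTLY the K-rows (`hK`, `hKall`) and the window
bookkeeping from the corresponding `FP.SymmetryInherit.…_of_cauchy` theorem; the S-rows (`hS`, `hSall`), the W-rows (`hW`, `hWall`), the `m = 1` pins and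
the finite-`j` symmetry rows `hRj` (an2) / `hWj` (an1) REMAIN HYPOTHESES.  NOT «N3 closed», NOT «G-an2-4 closed», NOT BetaPertH, NOT continuum, NOT Clay;
0 wall binders instantiated.  Claim table `HOME/b2b-balaban-beta-d1-p3/LEAVES-FP.md` row N3-inherit, sub-row N3-inherit-wall (unit
`b2b-balaban-beta-d1-formalise-leaf-06`).
ABSOLUTE RULE (cell, verbatim): «No internally-minted statement may enter as a cited fact. Every hypothesis is either kernel-proved in this package or a
verbatim quotation of a PUBLISHED theorem with page reference.»  Nothing is cited; no `def … : Prop`; every input is a tree theorem imported BY NAME.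

CONTENT (all [our object]; `d = 3`, `2 ≤ Lc`): **`tendsto_TbalOf_TPerfOf_one_holdsK`**, **`axisReflectionCovariant_flipK_TPerfOf_one_holdsK`**,
**`wardTransversal_flipK_TPerfOf_one_holdsK`**.
-/

namespace Summit.QuantumFields.BalabanUV.Beta.FP.SymmetryInheritHolds

open Filter Topology
open Literature.MathematicalPhysics.QuantumFieldTheory.Balaban1983to89
open Literature.MathematicalPhysics.QuantumFieldTheory.Balaban1983to89.Beta
open ExpKernelCalculus (MKer Decays VertexFamily₂)
open PolarizationSign (WardTransversal AxisReflectionCovariant)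
open OneStepResolventKernel (Fib LocStencil)
open OneStepKernelFamily (KInvStep TbalOf flipK)
open BalabanStepJetsSucc (JsBal0Of JsBalOf)
open Summit.QuantumFields.BalabanUV.Beta.HessKerDressedUnits (unitK unitS unitW)
open Summit.QuantumFields.BalabanUV.Beta.HessKerConvCKPlug (exists_merged_rows)
open Summit.QuantumFields.BalabanUV.Beta.GAN24.CombesThomas (sfStep smStep sfStep_ne_zero smStep_ne_zero)
open Summit.QuantumFields.BalabanUV.Beta.GAN24.KSlotAssembly (convCKWall_holds)
open Summit.QuantumFields.BalabanUV.Beta.FP.PerfectObjectsT (KPerf SPerfOf WPerfOf TPerfOf)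
open Summit.QuantumFields.BalabanUV.Beta.FP.SymmetryInherit (tendsto_TbalOf_TPerfOf_one_of_cauchy axisReflectionCovariant_flipK_TPerfOf_one_of_cauchy
  wardTransversal_flipK_TPerfOf_one_of_cauchy)

noncomputable section

variable {Lc : ℕ} [NeZero Lc] (hLc : 1 ≤ Lc) (cE cVH cΛ : ℝ)
  (W : ℕ → Fin (3 + 1) → (Fin (3 + 1) → ℤ) → Fin (3 + 1) → (Fin (3 + 1) → ℤ) → MKer (3 + 1) (Fib 3))
  (Cw' δw : ℕ → ℝ) (hδw : ∀ j, 0 < δw j) (hW' : ∀ j, VertexFamily₂ (W j) Lc (Cw' j) (δw j))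
  (S : ℕ → ℕ → Fin (3 + 1) → (Fin (3 + 1) → ℤ) → MKer (3 + 1) (Fib 3))
  (Wt : ℕ → ℕ → Fin (3 + 1) → (Fin (3 + 1) → ℤ) → Fin (3 + 1) → (Fin (3 + 1) → ℤ) → MKer (3 + 1) (Fib 3))
  {Cs cS δS θS Cw cW δW θW : ℝ}

/-- **THE WALL'S FAMILY CONVERGES ENTRYWISE TO THE PERFECT ONE-STEP KERNEL, K-ROWS DISCHARGED** (`d = 3`, `2 ≤ Lc`, adopted units): given ONLY the S-slot
rows (`hS`, `hSall` at rate `θS ∈ [0,1)`, decay `δS > 0`), the W-slot rows (`hW`, `hWall` at rate `θW ∈ [0,1)`, decay `δW > 0`) and the `m = 1` pins,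
`TbalOf Lc (JsBalOf …) j μ ν x → TPerfOf Lc (KPerf …1) (SPerfOf …1) (WPerfOf …1) μ ν x` — `SymmetryInherit.tendsto_TbalOf_TPerfOf_one_of_cauchy` with
`(hK, hKall)` from `convCKWall_holds` and the rate/window merged by `exists_merged_rows`. [our object] -/
theorem tendsto_TbalOf_TPerfOf_one_holdsK (hLc2 : 2 ≤ Lc)
    (hS1 : ∀ j, S j 1 = (JsBal0Of hLc cE cVH cΛ W Cw' δw hδw hW' j).S) (hW1 : ∀ j, Wt j 1 = W j)
    (hS : ∀ j, LocStencil (unitS (sfStep Lc j) (smStep 3 Lc j) (JsBal0Of hLc cE cVH cΛ W Cw' δw hδw hW' j).S) Cs δS)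
    (hSall : ∀ k j, LocStencil (unitS (sfStep Lc (k + j)) (smStep 3 Lc (k + j)) (JsBal0Of hLc cE cVH cΛ W Cw' δw hδw hW' (k + j)).S -
      unitS (sfStep Lc k) (smStep 3 Lc k) (JsBal0Of hLc cE cVH cΛ W Cw' δw hδw hW' k).S) (cS * θS ^ k) δS)
    (hW : ∀ j, VertexFamily₂ (unitW (sfStep Lc j) (smStep 3 Lc j) (W j)) Lc Cw δW)
    (hWall : ∀ k j, VertexFamily₂ (unitW (sfStep Lc (k + j)) (smStep 3 Lc (k + j)) (W (k + j)) - unitW (sfStep Lc k) (smStep 3 Lc k) (W k)) Lc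
      (cW * θW ^ k) δW)
    (hδS : 0 < δS) (hδW : 0 < δW) (hθS0 : 0 ≤ θS) (hθS1 : θS < 1) (hθW0 : 0 ≤ θW) (hθW1 : θW < 1) (μ ν : Fin 4) (x : Fin 4 → ℤ) :
    Tendsto (fun j => TbalOf Lc (JsBalOf hLc cE cVH cΛ W Cw' δw hδw hW') j μ ν x) atTop
      (𝓝 (TPerfOf Lc (KPerf (d := 3) Lc (sfStep Lc) (smStep 3 Lc) 1) (SPerfOf (sfStep Lc) (smStep 3 Lc) S 1)
        (WPerfOf (sfStep Lc) (smStep 3 Lc) Wt 1) μ ν x)) := by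
  obtain ⟨C, δK, cK, θ, R, hR, hRK, hRS, hRW, hθ0, hθ1, hK, hKall, hSall', hWall'⟩ :=
    exists_merged_rows (Lc := Lc) (convCKWall_holds hLc2)
      (S := fun j => unitS (sfStep Lc j) (smStep 3 Lc j) (JsBal0Of hLc cE cVH cΛ W Cw' δw hδw hW' j).S)
      (W := fun j => unitW (sfStep Lc j) (smStep 3 Lc j) (W j)) hSall hWall hδS hδW hθS0 hθS1 hθW0 hθW1
  exact tendsto_TbalOf_TPerfOf_one_of_cauchy hLc cE cVH cΛ W Cw' δw hδw hW' (sfStep Lc) (smStep 3 Lc) S Wt sfStep_ne_zero smStep_ne_zero hS1 hW1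
    hK hKall hS hSall' hW hWall' hR (by linarith) hRS hRW hθ0 hθ1 μ ν x

/-- **AXIS-REFLECTION COVARIANCE OF THE PERFECT ONE-STEP KERNEL FROM `hR`, K-ROWS DISCHARGED** (`d = 3`, `2 ≤ Lc`, adopted units): an2's finite-`j` row
`∀ j, AxisReflectionCovariant (flipK (TbalOf Lc (JsBalOf …) j))` + the S- and W-slot rows + the `m = 1` pins ⟹
`AxisReflectionCovariant (flipK (TPerfOf Lc (KPerf …1) (SPerfOf …1) (WPerfOf …1)))`. [our object] -/
theorem axisReflectionCovariant_flipK_TPerfOf_one_holdsK (hLc2 : 2 ≤ Lc)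
    (hS1 : ∀ j, S j 1 = (JsBal0Of hLc cE cVH cΛ W Cw' δw hδw hW' j).S) (hW1 : ∀ j, Wt j 1 = W j)
    (hS : ∀ j, LocStencil (unitS (sfStep Lc j) (smStep 3 Lc j) (JsBal0Of hLc cE cVH cΛ W Cw' δw hδw hW' j).S) Cs δS)
    (hSall : ∀ k j, LocStencil (unitS (sfStep Lc (k + j)) (smStep 3 Lc (k + j)) (JsBal0Of hLc cE cVH cΛ W Cw' δw hδw hW' (k + j)).S -
      unitS (sfStep Lc k) (smStep 3 Lc k) (JsBal0Of hLc cE cVH cΛ W Cw' δw hδw hW' k).S) (cS * θS ^ k) δS)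
    (hW : ∀ j, VertexFamily₂ (unitW (sfStep Lc j) (smStep 3 Lc j) (W j)) Lc Cw δW)
    (hWall : ∀ k j, VertexFamily₂ (unitW (sfStep Lc (k + j)) (smStep 3 Lc (k + j)) (W (k + j)) - unitW (sfStep Lc k) (smStep 3 Lc k) (W k)) Lc
      (cW * θW ^ k) δW)
    (hδS : 0 < δS) (hδW : 0 < δW) (hθS0 : 0 ≤ θS) (hθS1 : θS < 1) (hθW0 : 0 ≤ θW) (hθW1 : θW < 1)
    (hRj : ∀ j, AxisReflectionCovariant (flipK (TbalOf Lc (JsBalOf hLc cE cVH cΛ W Cw' δw hδw hW') j))) :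
    AxisReflectionCovariant (flipK (TPerfOf Lc (KPerf (d := 3) Lc (sfStep Lc) (smStep 3 Lc) 1) (SPerfOf (sfStep Lc) (smStep 3 Lc) S 1)
      (WPerfOf (sfStep Lc) (smStep 3 Lc) Wt 1))) := by
  obtain ⟨C, δK, cK, θ, R, hR, hRK, hRS, hRW, hθ0, hθ1, hK, hKall, hSall', hWall'⟩ :=
    exists_merged_rows (Lc := Lc) (convCKWall_holds hLc2)
      (S := fun j => unitS (sfStep Lc j) (smStep 3 Lc j) (JsBal0Of hLc cE cVH cΛ W Cw' δw hδw hW' j).S)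
      (W := fun j => unitW (sfStep Lc j) (smStep 3 Lc j) (W j)) hSall hWall hδS hδW hθS0 hθS1 hθW0 hθW1
  exact axisReflectionCovariant_flipK_TPerfOf_one_of_cauchy hLc cE cVH cΛ W Cw' δw hδw hW' (sfStep Lc) (smStep 3 Lc) S Wt sfStep_ne_zero
    smStep_ne_zero hS1 hW1 hK hKall hS hSall' hW hWall' hR (by linarith) hRS hRW hθ0 hθ1 hRj

/-- **WARD TRANSVERSALITY OF THE PERFECT ONE-STEP KERNEL FROM `hW`, K-ROWS DISCHARGED** (`d = 3`, `2 ≤ Lc`, adopted units). [our object] -/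
theorem wardTransversal_flipK_TPerfOf_one_holdsK (hLc2 : 2 ≤ Lc)
    (hS1 : ∀ j, S j 1 = (JsBal0Of hLc cE cVH cΛ W Cw' δw hδw hW' j).S) (hW1 : ∀ j, Wt j 1 = W j)
    (hS : ∀ j, LocStencil (unitS (sfStep Lc j) (smStep 3 Lc j) (JsBal0Of hLc cE cVH cΛ W Cw' δw hδw hW' j).S) Cs δS)
    (hSall : ∀ k j, LocStencil (unitS (sfStep Lc (k + j)) (smStep 3 Lc (k + j)) (JsBal0Of hLc cE cVH cΛ W Cw' δw hδw hW' (k + j)).S -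
      unitS (sfStep Lc k) (smStep 3 Lc k) (JsBal0Of hLc cE cVH cΛ W Cw' δw hδw hW' k).S) (cS * θS ^ k) δS)
    (hW : ∀ j, VertexFamily₂ (unitW (sfStep Lc j) (smStep 3 Lc j) (W j)) Lc Cw δW)
    (hWall : ∀ k j, VertexFamily₂ (unitW (sfStep Lc (k + j)) (smStep 3 Lc (k + j)) (W (k + j)) - unitW (sfStep Lc k) (smStep 3 Lc k) (W k)) Lc
      (cW * θW ^ k) δW)
    (hδS : 0 < δS) (hδW : 0 < δW) (hθS0 : 0 ≤ θS) (hθS1 : θS < 1) (hθW0 : 0 ≤ θW) (hθW1 : θW < 1)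
    (hWj : ∀ j, WardTransversal (flipK (TbalOf Lc (JsBalOf hLc cE cVH cΛ W Cw' δw hδw hW') j))) :
    WardTransversal (flipK (TPerfOf Lc (KPerf (d := 3) Lc (sfStep Lc) (smStep 3 Lc) 1) (SPerfOf (sfStep Lc) (smStep 3 Lc) S 1)
      (WPerfOf (sfStep Lc) (smStep 3 Lc) Wt 1))) := by
  obtain ⟨C, δK, cK, θ, R, hR, hRK, hRS, hRW, hθ0, hθ1, hK, hKall, hSall', hWall'⟩ :=
    exists_merged_rows (Lc := Lc) (convCKWall_holds hLc2)
      (S := fun j => unitS (sfStep Lc j) (smStep 3 Lc j) (JsBal0Of hLc cE cVH cΛ W Cw' δw hδw hW' j).S)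
      (W := fun j => unitW (sfStep Lc j) (smStep 3 Lc j) (W j)) hSall hWall hδS hδW hθS0 hθS1 hθW0 hθW1
  exact wardTransversal_flipK_TPerfOf_one_of_cauchy hLc cE cVH cΛ W Cw' δw hδw hW' (sfStep Lc) (smStep 3 Lc) S Wt sfStep_ne_zero smStep_ne_zero
    hS1 hW1 hK hKall hS hSall' hW hWall' hR (by linarith) hRS hRW hθ0 hθ1 hWj

end

end Summit.QuantumFields.BalabanUV.Beta.FP.SymmetryInheritHolds
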